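import Literature.MathematicalPhysics.QuantumFieldTheory.WilsonFinTorusSpectralData
import HarnessLib

/-!
# ENGINE-KL layer (K1) for `SqueezedSkewness.TorusKL` (stmt-QuantumFields-23204, stub `stub_torusMixtureData`): SPATIAL TRANSLATIONS OF
# THE SLICES commute with the Wilson transfer operator

The Källén–Lehmann data of the registered stubs `stub_torusMixtureData` (23204), `stub_osData` (22796), `stub_limitDomination`
(28192) need, next to the transfer operator `𝕋` of the spatial torus `S³` (tree: `finTorusSliceKernel`,
`exists_spectralData_wilsonFinTorusPartition_box`), the unitary spatial translations `U_v` COMMUTING with `𝕋`.  This file supplies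
them (sizing memo `SIZING-23204-…`, layer K1): for `v ∈ (Fin S)³` the slice translation `τ_v a = a ∘ (· + v)` and the link
translation `σ_v g = g ∘ (· + v)`
* leave the slab energies invariant (`finTorusSpatialAction_translate`, `finTorusTemporalAction_translate`; the unit shifts
  commute with translations, `shift_add`), preserve the product Haar measures, hence leave the slice kernel invariant
  (`finTorusSliceKernel_translate`);
* induce norm-preserving operators `U_v` on `L²(slices)` (Mathlib `Lp.compMeasurePreservingₗᵢ`) with `U_0 = 1`,
  `U_{v+w} = U_v U_w`, commuting with ANY bounded operator represented by the slice kernel (`exists_translationOps`).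
Mathlib + `WilsonFinTorusSlice*` only; no definitions; nothing about a summit, NT or the mass gap is proved. [folklore]
[cite: MontvayMunster1994, §3.2.6] [cite: Luscher1977]
-/

set_option autoImplicit false

noncomputable section

open MeasureTheory Filter
open Literature.MathematicalPhysics.QuantumFieldTheory

namespace Summit.QuantumFields.YangMills.Theorems.TorusKLSliceTranslations

variable {S : ℕ} [NeZero S] {G : Type*} [Group G] {N : ℕ} (ρ : G →* Matrix (Fin N) (Fin N) ℂ)

/-! ## §1 Translations of spatial sites commute with the unit shifts -/

omit [NeZero S] in
/-- `(p + v) + eᵢ = (p + eᵢ) + v` on the periodic box `(Fin S)³`. [folklore] -/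
theorem shift_add (p v : FinSpatialSite S S S) (i : Fin 3) : (p + v).shift i = p.shift i + v := by
  obtain ⟨a, b, c⟩ := p
  obtain ⟨x, y, z⟩ := v
  fin_cases i <;> simp [FinSpatialSite.shift, Prod.mk_add_mk, add_right_comm]

/-! ## §2 The slab energies are translation invariant -/

/-- **Spatial plaquette energy of a translated slice** `= ` that of the slice. [cite: MontvayMunster1994, §3.2.6 (3.140)] -/
theorem finTorusSpatialAction_translate (v : FinSpatialSite S S S) (a : FinSpatialSite S S S × Fin 3 → G) :
    finTorusSpatialAction ρ (fun l : FinSpatialSite S S S × Fin 3 => a (l.1 + v, l.2)) = finTorusSpatialAction ρ a := by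
  unfold finTorusSpatialAction
  simp only [← shift_add]
  exact Fintype.sum_equiv (Equiv.addRight v) _ _ fun p => rfl

/-- **Temporal plaquette energy of a translated slab** `=` that of the slab. [cite: MontvayMunster1994, §3.2.6 (3.141)] -/
theorem finTorusTemporalAction_translate (v : FinSpatialSite S S S) (a : FinSpatialSite S S S × Fin 3 → G)
    (g : FinSpatialSite S S S → G) (b : FinSpatialSite S S S × Fin 3 → G) :
    finTorusTemporalAction ρ (fun l : FinSpatialSite S S S × Fin 3 => a (l.1 + v, l.2)) (fun p => g (p + v))
        (fun l : FinSpatialSite S S S × Fin 3 => b (l.1 + v, l.2)) = finTorusTemporalAction ρ a g b := by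
  unfold finTorusTemporalAction
  simp only [← shift_add]
  exact Fintype.sum_equiv (Equiv.addRight v) _ _ fun p => rfl

/-! ## §3 Translations preserve the product Haar measures -/

section Measure

variable [MeasurableSpace G] (ν : Measure G) [SigmaFinite ν]

omit [Group G] in
/-- The slice translation as a measurable equivalence (a relabelling of the link coordinates). [folklore] -/
theorem coe_sliceTranslate (v : FinSpatialSite S S S) :
    ⇑(MeasurableEquiv.piCongrLeft (fun _ : FinSpatialSite S S S × Fin 3 => G)
        ((Equiv.addRight v).prodCongr (Equiv.refl (Fin 3))).symm) =
      fun (a : FinSpatialSite S S S × Fin 3 → G) (l : FinSpatialSite S S S × Fin 3) => a (l.1 + v, l.2) := by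
  funext a l
  simp only [MeasurableEquiv.coe_piCongrLeft, Equiv.piCongrLeft_apply_eq_cast, cast_eq, Equiv.symm_symm,
    Equiv.prodCongr_apply, Equiv.coe_refl, Equiv.coe_addRight]
  rfl

omit [Group G] in
/-- The link translation as a measurable equivalence. [folklore] -/
theorem coe_linkTranslate (v : FinSpatialSite S S S) :
    ⇑(MeasurableEquiv.piCongrLeft (fun _ : FinSpatialSite S S S => G) (Equiv.addRight v).symm) =
      fun (g : FinSpatialSite S S S → G) (p : FinSpatialSite S S S) => g (p + v) := by
  funext g p
  simp only [MeasurableEquiv.coe_piCongrLeft, Equiv.piCongrLeft_apply_eq_cast, cast_eq, Equiv.symm_symm, Equiv.coe_addRight]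

omit [Group G] in
/-- **Slice translations preserve the product measure** on the spatial links. [folklore] -/
theorem measurePreserving_sliceTranslate (v : FinSpatialSite S S S) :
    MeasurePreserving (fun (a : FinSpatialSite S S S × Fin 3 → G) (l : FinSpatialSite S S S × Fin 3) => a (l.1 + v, l.2))
      (Measure.pi fun _ : FinSpatialSite S S S × Fin 3 => ν) (Measure.pi fun _ : FinSpatialSite S S S × Fin 3 => ν) := by
  rw [← coe_sliceTranslate]
  exact measurePreserving_piCongrLeft (fun _ : FinSpatialSite S S S × Fin 3 => ν) _

omit [Group G] in
/-- **Link translations preserve the product measure** on the temporal links. [folklore] -/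
theorem measurePreserving_linkTranslate (v : FinSpatialSite S S S) :
    MeasurePreserving (fun (g : FinSpatialSite S S S → G) (p : FinSpatialSite S S S) => g (p + v))
      (Measure.pi fun _ : FinSpatialSite S S S => ν) (Measure.pi fun _ : FinSpatialSite S S S => ν) := by
  rw [← coe_linkTranslate]
  exact measurePreserving_piCongrLeft (fun _ : FinSpatialSite S S S => ν) _

end Measure

/-! ## §4 The slice kernel is translation invariant -/

section Kernel

variable [TopologicalSpace G] [IsTopologicalGroup G] [CompactSpace G] [MeasurableSpace G] [BorelSpace G]

/-- **`K_β(τ_v a, τ_v b) = K_β(a, b)`** — substitute the temporal links `g ↦ σ_v g` in the Haar integral of the slice kernel.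
[cite: MontvayMunster1994, §3.2.6 (3.144)] -/
theorem finTorusSliceKernel_translate (β : ℝ) (v : FinSpatialSite S S S) (a b : FinSpatialSite S S S × Fin 3 → G) :
    finTorusSliceKernel ρ β (fun l : FinSpatialSite S S S × Fin 3 => a (l.1 + v, l.2))
        (fun l : FinSpatialSite S S S × Fin 3 => b (l.1 + v, l.2)) = finTorusSliceKernel ρ β a b := by
  unfold finTorusSliceKernel
  rw [finTorusSpatialAction_translate, finTorusSpatialAction_translate]
  congr 2
  have h := (measurePreserving_piCongrLeft (fun _ : FinSpatialSite S S S => haarProbability G)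
    (Equiv.addRight v).symm).integral_comp' (g := fun g : FinSpatialSite S S S → G =>
      Real.exp (-(β * finTorusTemporalAction ρ (fun l : FinSpatialSite S S S × Fin 3 => a (l.1 + v, l.2)) g
        (fun l : FinSpatialSite S S S × Fin 3 => b (l.1 + v, l.2)))))
  rw [coe_linkTranslate] at h
  rw [← h]
  refine integral_congr_ae (Eventually.of_forall fun g => ?_)
  dsimp only
  rw [finTorusTemporalAction_translate]

end Kernel

/-! ## §5 Norm-preserving translations of `L²(slices)` commuting with the transfer operator -/

section Operators

variable [TopologicalSpace G] [IsTopologicalGroup G] [CompactSpace G] [MeasurableSpace G] [BorelSpace G]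

/-- **ENGINE-KL layer (K1).**  On `L²` of the slice configurations (product Haar measure) the spatial translations act by
norm-preserving operators `U_v φ = φ ∘ τ_v` with `U_0 = 1`, `U_{v+w} = U_v U_w`, and they COMMUTE with every bounded operator `A`
represented by the slice kernel `finTorusSliceKernel ρ β` (the transfer operator of `exists_spectralData_wilsonFinTorusPartition_box` /
`FinTorusWindow.hasSum_window_rotated`), because the kernel is translation invariant. [cite: MontvayMunster1994, §3.2.6] [cite: Luscher1977] -/
theorem exists_translationOps (β : ℝ)
    (A : Lp ℝ 2 (Measure.pi fun _ : FinSpatialSite S S S × Fin 3 => haarProbability G) →L[ℝ]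
      Lp ℝ 2 (Measure.pi fun _ : FinSpatialSite S S S × Fin 3 => haarProbability G))
    (hA : ∀ φ, (A φ : (FinSpatialSite S S S × Fin 3 → G) → ℝ)
      =ᵐ[Measure.pi fun _ : FinSpatialSite S S S × Fin 3 => haarProbability G]
        fun x => ∫ y, finTorusSliceKernel ρ β x y * φ y ∂(Measure.pi fun _ : FinSpatialSite S S S × Fin 3 => haarProbability G)) :
    ∃ U : FinSpatialSite S S S → (Lp ℝ 2 (Measure.pi fun _ : FinSpatialSite S S S × Fin 3 => haarProbability G) →L[ℝ]
        Lp ℝ 2 (Measure.pi fun _ : FinSpatialSite S S S × Fin 3 => haarProbability G)),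
      (∀ v φ, (U v φ : (FinSpatialSite S S S × Fin 3 → G) → ℝ)
        =ᵐ[Measure.pi fun _ : FinSpatialSite S S S × Fin 3 => haarProbability G]
          fun a => φ (fun l : FinSpatialSite S S S × Fin 3 => a (l.1 + v, l.2))) ∧
      U 0 = 1 ∧ (∀ v w, U (v + w) = U v * U w) ∧ (∀ v φ, ‖U v φ‖ = ‖φ‖) ∧ (∀ v, A * U v = U v * A) := by
  have hτ : ∀ v : FinSpatialSite S S S, MeasurePreserving
      (fun (a : FinSpatialSite S S S × Fin 3 → G) (l : FinSpatialSite S S S × Fin 3) => a (l.1 + v, l.2)) (Measure.pi fun _ : FinSpatialSite S S S × Fin 3 => haarProbability G) (Measure.pi fun _ : FinSpatialSite S S S × Fin 3 => haarProbability G) :=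
    fun v => measurePreserving_sliceTranslate (haarProbability G) v
  set U : FinSpatialSite S S S → (Lp ℝ 2 (Measure.pi fun _ : FinSpatialSite S S S × Fin 3 => haarProbability G) →L[ℝ] Lp ℝ 2 (Measure.pi fun _ : FinSpatialSite S S S × Fin 3 => haarProbability G)) := fun v =>
    (Lp.compMeasurePreservingₗᵢ ℝ (fun (a : FinSpatialSite S S S × Fin 3 → G) (l : FinSpatialSite S S S × Fin 3) =>
      a (l.1 + v, l.2)) (hτ v)).toContinuousLinearMap with hUdef
  have hU : ∀ v φ, (U v φ : (FinSpatialSite S S S × Fin 3 → G) → ℝ) =ᵐ[(Measure.pi fun _ : FinSpatialSite S S S × Fin 3 => haarProbability G)]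
      fun a => φ (fun l : FinSpatialSite S S S × Fin 3 => a (l.1 + v, l.2)) :=
    fun v φ => Lp.coeFn_compMeasurePreserving φ (hτ v)
  refine ⟨U, hU, ?_, ?_, ?_, ?_⟩
  · -- `U 0 = 1`
    ext1 φ
    refine Lp.ext ((hU 0 φ).trans (Eventually.of_forall fun a => ?_))
    simp only [add_zero, Prod.mk.eta]
    rfl
  · -- `U (v + w) = U v ∘ U w`
    intro v w
    ext1 φ
    refine Lp.ext ((hU (v + w) φ).trans ?_)
    have h1 : ((U v (U w φ) : Lp ℝ 2 (Measure.pi fun _ : FinSpatialSite S S S × Fin 3 => haarProbability G)) : (FinSpatialSite S S S × Fin 3 → G) → ℝ) =ᵐ[(Measure.pi fun _ : FinSpatialSite S S S × Fin 3 => haarProbability G)]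
        fun a => (U w φ : (FinSpatialSite S S S × Fin 3 → G) → ℝ)
          (fun l : FinSpatialSite S S S × Fin 3 => a (l.1 + v, l.2)) := hU v (U w φ)
    have h2 := (hτ v).quasiMeasurePreserving.ae_eq_comp (hU w φ)
    refine ((h1.trans h2).trans (Eventually.of_forall fun a => ?_)).symm
    simp only [Function.comp_apply]
    congr 1
    funext l
    rw [add_assoc, add_comm w v]
  · -- norm preserving
    intro v φ
    exact (Lp.compMeasurePreservingₗᵢ ℝ _ (hτ v)).norm_map φ
  · -- commuting with the transfer operator
    intro v
    ext1 φ
    refine Lp.ext ?_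
    have hK := finTorusSliceKernel_translate ρ β v
    set e : (FinSpatialSite S S S × Fin 3 → G) ≃ᵐ (FinSpatialSite S S S × Fin 3 → G) :=
      MeasurableEquiv.piCongrLeft (fun _ : FinSpatialSite S S S × Fin 3 => G)
        ((Equiv.addRight v).prodCongr (Equiv.refl (Fin 3))).symm with he
    have hτe : MeasurePreserving e (Measure.pi fun _ : FinSpatialSite S S S × Fin 3 => haarProbability G) (Measure.pi fun _ : FinSpatialSite S S S × Fin 3 => haarProbability G) :=
      measurePreserving_piCongrLeft (fun _ : FinSpatialSite S S S × Fin 3 => haarProbability G) _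
    have hecoe : ∀ a : FinSpatialSite S S S × Fin 3 → G,
        e a = fun l : FinSpatialSite S S S × Fin 3 => a (l.1 + v, l.2) := fun a => by
      rw [he, coe_sliceTranslate]
    -- left-hand side: `A (U_v φ) = ∫ K(x,y) φ(τ y) dy = ∫ K(τ x, y) φ(y) dy`
    have hL : ((A (U v φ) : Lp ℝ 2 (Measure.pi fun _ : FinSpatialSite S S S × Fin 3 => haarProbability G)) : (FinSpatialSite S S S × Fin 3 → G) → ℝ) =ᵐ[(Measure.pi fun _ : FinSpatialSite S S S × Fin 3 => haarProbability G)]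
        fun x => ∫ y, finTorusSliceKernel ρ β (fun l : FinSpatialSite S S S × Fin 3 => x (l.1 + v, l.2)) y * φ y ∂(Measure.pi fun _ : FinSpatialSite S S S × Fin 3 => haarProbability G) := by
      refine (hA (U v φ)).trans (Eventually.of_forall fun x => ?_)
      dsimp only
      have h1 : ∫ y, finTorusSliceKernel ρ β x y * (U v φ : (FinSpatialSite S S S × Fin 3 → G) → ℝ) y ∂(Measure.pi fun _ : FinSpatialSite S S S × Fin 3 => haarProbability G) =
          ∫ y, finTorusSliceKernel ρ β x y * φ (fun l : FinSpatialSite S S S × Fin 3 => y (l.1 + v, l.2)) ∂(Measure.pi fun _ : FinSpatialSite S S S × Fin 3 => haarProbability G) :=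
        integral_congr_ae ((hU v φ).mono fun y hy => by dsimp only; rw [hy])
      have h2 : ∫ y, finTorusSliceKernel ρ β x y * φ (fun l : FinSpatialSite S S S × Fin 3 => y (l.1 + v, l.2)) ∂(Measure.pi fun _ : FinSpatialSite S S S × Fin 3 => haarProbability G) =
          ∫ y', finTorusSliceKernel ρ β x (e.symm y') * φ y' ∂(Measure.pi fun _ : FinSpatialSite S S S × Fin 3 => haarProbability G) := by
        refine Eq.trans (integral_congr_ae (Eventually.of_forall fun y => ?_))
          (hτe.integral_comp' (g := fun y' => finTorusSliceKernel ρ β x (e.symm y') * φ y'))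
        dsimp only
        rw [MeasurableEquiv.symm_apply_apply, hecoe]
      rw [h1, h2]
      refine integral_congr_ae (Eventually.of_forall fun y => ?_)
      dsimp only
      congr 1
      have h3 := hK x (e.symm y)
      rw [← hecoe (e.symm y), MeasurableEquiv.apply_symm_apply] at h3
      rw [← h3]
    -- right-hand side: `U_v (A φ) = (A φ) ∘ τ_v`
    have hR : ((U v (A φ) : Lp ℝ 2 (Measure.pi fun _ : FinSpatialSite S S S × Fin 3 => haarProbability G)) : (FinSpatialSite S S S × Fin 3 → G) → ℝ) =ᵐ[(Measure.pi fun _ : FinSpatialSite S S S × Fin 3 => haarProbability G)]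
        fun x => ∫ y, finTorusSliceKernel ρ β (fun l : FinSpatialSite S S S × Fin 3 => x (l.1 + v, l.2)) y * φ y ∂(Measure.pi fun _ : FinSpatialSite S S S × Fin 3 => haarProbability G) :=
      (hU v (A φ)).trans ((hτ v).quasiMeasurePreserving.ae_eq_comp (hA φ))
    exact hL.trans hR.symm

end Operators

end Summit.QuantumFields.YangMills.Theorems.TorusKLSliceTranslations

end
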